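import Summits.AtomisticToContinuum.HydrodynamicLimit.Theorems.DensityCap.Negative.MollifiedDensity
import Literature.Analysis.FluidPDE.HardSphereDynamicsProofs

/-!
# Global equilibrium is stationary: flow invariance of the homogeneous local Gibbs law, and the hydrodynamic limit at equilibrium

Negative-side structure for the crux `JParityClosure.DensityCap` (stmt-AtomisticToContinuum-13082), from the standing
disprover's `Cruxes/DensityCap/Disproof.lean` §5 (cycle 1): the EQUILIBRIUM INSTANCE CARRIES NO INFORMATION about the
crux (nor about any item of the sub-problem tied to constant profiles), because it is settled by stationarity alone:
* `tensorPow_homogeneous` — the homogeneous local Gibbs density is `(2π)^{-3n/2} e^{-E(z)} 𝟙_D(z)`, a function of the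
  kinetic energy `E(z) = ½∑|vᵢ|²`;
* `canonicalDensity_flow_homogeneous` — it is conserved along good trajectories (invariance of the good set ⊆ domain,
  energy conservation `IsHardSphereTrajectory.configEnergy_eq_holds`);
* `map_flow_localGibbsLaw_homogeneous` — **the homogeneous local Gibbs law `localGibbsLaw σ 1 0 1 N Φ` is invariant under
  `Φ(t)` for every `t`** (Liouville `HardSphereFlow.measurePreserving` + the two facts above);
* `localGibbsLaw_preimage_flow_le` / `localGibbsLaw_preimage_flow_le_zero` — transported events (ANY set, outer measure)
  do not gain probability;
* `tendstoHydroFieldsAt_homogeneous` — **the hydrodynamic limit holds at global equilibrium at EVERY time**: for the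
  profiles `(1,1,0)` and `σ < σ₁` (`DensityCapNegative.homogeneous_lln`), through every flow family, the empirical
  density / momentum / energy fields at time `t` converge in probability to those of the constant Euler state `(1,0,1)`
  (the `t = 0` LLN transported by invariance).
refuter-cdisprove-stmt-AtomisticToContinuum-13082-0.
-/

noncomputable section

namespace Summit.AtomisticToContinuum.HydrodynamicLimit.Theorems.DensityCapNegative

open MeasureTheory Filter Set Topology
open scoped ENNReal
open Literature.MathematicalPhysics.KineticTheory Literature.Analysis.FluidPDE
open Literature.Analysis.FunctionSpaces
open Summit.AtomisticToContinuum.HydrodynamicLimit.Theorems.PolynomialCompressionPDE (Flows flows_nonempty)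

/-- The homogeneous local Gibbs profile `(a₀, u₀, θ₀) = (1, 0, 1)` is the global Maxwellian of the speed:
`(2π)^{-3/2} e^{-|v|²/2}`. -/
theorem localGibbsProfile_homogeneous (y : T3 × V3) :
    localGibbsProfile (fun _ => 1) (fun _ => 0) (fun _ => 1) y =
      (2 * Real.pi) ^ (-(3 : ℝ) / 2) * Real.exp (-‖y.2‖ ^ 2 / 2) := by
  simp [localGibbsProfile, localMaxwellian]

/-- Its tensor power is a function of the kinetic energy: `∏ᵢ M(vᵢ) = (2π)^{-3n/2} e^{-E(z)}`, `E = ½∑|vᵢ|²`. -/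
theorem tensorPow_homogeneous {n : ℕ} (z : Config n (Fin 3) T3) :
    tensorPow n (localGibbsProfile (fun _ => 1) (fun _ => 0) (fun _ => 1)) z =
      ((2 * Real.pi) ^ (-(3 : ℝ) / 2)) ^ n * Real.exp (-configEnergy z) := by
  unfold tensorPow
  simp_rw [localGibbsProfile_homogeneous]
  rw [Finset.prod_mul_distrib, Finset.prod_const, Finset.card_univ, Fintype.card_fin, ← Real.exp_sum]
  congr 2
  rw [configEnergy, Finset.mul_sum, ← Finset.sum_neg_distrib]
  exact Finset.sum_congr rfl fun i _ => by ring

variable {σ : ℝ} {N : ℕ}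

/-- Along the flow of a good configuration the homogeneous canonical density is conserved (the domain indicator by
invariance of the good set, the Maxwellian factor by conservation of the kinetic energy). -/
theorem canonicalDensity_flow_homogeneous
    (Φ : HardSphereFlow (Torus.geometry (Fin 3)) (hsDiameter σ N) (N + 1)) (t : ℝ)
    {z : Config (N + 1) (Fin 3) T3} (hz : z ∈ Φ.good) :
    canonicalDensity (Torus.geometry (Fin 3)) (hsDiameter σ N) (N + 1)
        (localGibbsProfile (fun _ => 1) (fun _ => 0) (fun _ => 1)) (Φ.flow t z) =
      canonicalDensity (Torus.geometry (Fin 3)) (hsDiameter σ N) (N + 1)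
        (localGibbsProfile (fun _ => 1) (fun _ => 0) (fun _ => 1)) z := by
  have hzt : Φ.flow t z ∈ Φ.good := Φ.mapsTo_good t hz
  have hD : z ∈ hardSphereDomain (Torus.geometry (Fin 3)) (N + 1) (hsDiameter σ N) := Φ.good_subset hz
  have hDt : Φ.flow t z ∈ hardSphereDomain (Torus.geometry (Fin 3)) (N + 1) (hsDiameter σ N) :=
    Φ.good_subset hzt
  have hE : configEnergy (Φ.flow t z) = configEnergy z := by
    have h := IsHardSphereTrajectory.configEnergy_eq_holds (Φ.isTrajectory z hz) t 0
    simpa [Φ.flow_zero z hz] using h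
  simp only [canonicalDensity, Set.indicator_of_mem hD, Set.indicator_of_mem hDt, tensorPow_homogeneous, hE]

/-- **Flow invariance of the homogeneous local Gibbs law** (global equilibrium is stationary): the push-forward of
`localGibbsLaw σ 1 0 1 N Φ` under `Φ(t)` is itself, for every `t` (Liouville's theorem `measurePreserving` + energy
conservation `configEnergy_eq_holds` + invariance of the good set). -/
theorem map_flow_localGibbsLaw_homogeneous
    (Φ : HardSphereFlow (Torus.geometry (Fin 3)) (hsDiameter σ N) (N + 1)) (t : ℝ) :
    (localGibbsLaw σ (fun _ => 1) (fun _ => 0) (fun _ => 1) N Φ).map (Φ.flow t) =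
      localGibbsLaw σ (fun _ => 1) (fun _ => 0) (fun _ => 1) N Φ := by
  set g : Config (N + 1) (Fin 3) T3 → ℝ≥0∞ := fun z => ENNReal.ofReal
    (canonicalDensity (Torus.geometry (Fin 3)) (hsDiameter σ N) (N + 1)
      (localGibbsProfile (fun _ => 1) (fun _ => 0) (fun _ => 1)) z) with hgdef
  have hg : Measurable g :=
    (measurable_canonicalDensity (hsDiameter σ N) (N + 1)
      (measurable_localGibbsProfile continuous_const continuous_const continuous_const)).ennreal_ofReal
  have hL : localGibbsLaw σ (fun _ => 1) (fun _ => 0) (fun _ => 1) N Φ =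
      (liouville (Torus.geometry (Fin 3)) (N + 1) (hsDiameter σ N)).withDensity g := rfl
  have hinv : ∀ᵐ z ∂(liouville (Torus.geometry (Fin 3)) (N + 1) (hsDiameter σ N)), g (Φ.flow t z) = g z := by
    filter_upwards [Φ.ae_mem_good] with z hz
    simp only [hgdef, canonicalDensity_flow_homogeneous Φ t hz]
  ext A hA
  rw [Measure.map_apply (Φ.measurable_flow t) hA, hL, withDensity_apply _ (Φ.measurable_flow t hA),
    withDensity_apply _ hA, ← lintegral_indicator (Φ.measurable_flow t hA), ← lintegral_indicator hA]
  have h1 : (fun z => ((Φ.flow t) ⁻¹' A).indicator g z) =ᵐ[liouville (Torus.geometry (Fin 3)) (N + 1) (hsDiameter σ N)]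
      fun z => (A.indicator g) (Φ.flow t z) := by
    filter_upwards [hinv] with z hz
    show ((Φ.flow t) ⁻¹' A).indicator g z = A.indicator g (Φ.flow t z)
    by_cases hA' : Φ.flow t z ∈ A
    · rw [Set.indicator_of_mem (show z ∈ (Φ.flow t) ⁻¹' A from hA'), Set.indicator_of_mem hA', hz]
    · rw [Set.indicator_of_notMem (show z ∉ (Φ.flow t) ⁻¹' A from hA'), Set.indicator_of_notMem hA']
  rw [lintegral_congr_ae h1]
  exact (Φ.measurePreserving t).lintegral_comp (hg.indicator hA)

/-- Consequence for ALL (outer-measured) events: transporting an event by the flow does not increase its homogeneous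
local Gibbs probability. -/
theorem localGibbsLaw_preimage_flow_le
    (Φ : HardSphereFlow (Torus.geometry (Fin 3)) (hsDiameter σ N) (N + 1)) (t : ℝ)
    (S : Set (Config (N + 1) (Fin 3) T3)) :
    localGibbsLaw σ (fun _ => 1) (fun _ => 0) (fun _ => 1) N Φ ((Φ.flow t) ⁻¹' S) ≤
      localGibbsLaw σ (fun _ => 1) (fun _ => 0) (fun _ => 1) N Φ S := by
  calc localGibbsLaw σ (fun _ => 1) (fun _ => 0) (fun _ => 1) N Φ ((Φ.flow t) ⁻¹' S)
      ≤ (localGibbsLaw σ (fun _ => 1) (fun _ => 0) (fun _ => 1) N Φ).map (Φ.flow t) S :=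
        Measure.le_map_apply (Φ.measurable_flow t).aemeasurable S
    _ = _ := by rw [map_flow_localGibbsLaw_homogeneous]

/-- Transport at time `t` versus time `0`. -/
theorem localGibbsLaw_preimage_flow_le_zero
    (Φ : HardSphereFlow (Torus.geometry (Fin 3)) (hsDiameter σ N) (N + 1)) (t : ℝ)
    (S : Set (Config (N + 1) (Fin 3) T3)) :
    localGibbsLaw σ (fun _ => 1) (fun _ => 0) (fun _ => 1) N Φ ((Φ.flow t) ⁻¹' S) ≤
      localGibbsLaw σ (fun _ => 1) (fun _ => 0) (fun _ => 1) N Φ ((Φ.flow 0) ⁻¹' S) := by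
  rw [localGibbsLaw_preimage_flow_zero, ← localGibbsLaw_eq σ _ _ _ N Φ]
  exact localGibbsLaw_preimage_flow_le Φ t S

/-- **The hydrodynamic limit holds at global equilibrium, at every time.** For the homogeneous profiles `(1,1,0)` and
`σ < σ₁` (`lln_rhoLim` threshold), through every flow family, the empirical fields at EVERY time `t` converge in
probability to those of the constant state `(1,0,1)`: the `t = 0` LLN transported by flow invariance. -/
theorem tendstoHydroFieldsAt_homogeneous :
    ∃ σ₁ : ℝ, 0 < σ₁ ∧ σ₁ ≤ 1 / 2 ∧ ∀ σ : ℝ, 0 < σ → σ < σ₁ → ∀ Φ : Flows σ, ∀ t : ℝ,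
      TendstoHydroFieldsAt (fun N => localGibbsLaw σ (fun _ => 1) (fun _ => 0) (fun _ => 1) N (Φ N)) Φ
        (fun _ _ => 1) (fun _ _ => 0) (fun _ _ => 1) t := by
  obtain ⟨σ₁, hσ₁, h12, H⟩ := homogeneous_lln
  refine ⟨σ₁, hσ₁, h12, fun σ hσ hσ1 Φ t => ?_⟩
  obtain ⟨-, hT⟩ := H σ hσ hσ1 Φ
  intro χ hχ δ hδ
  obtain ⟨h1, h2, h3⟩ := hT χ hχ δ hδ
  refine ⟨?_, ?_, ?_⟩
  · exact tendsto_of_tendsto_of_tendsto_of_le_of_le tendsto_const_nhds h1 (fun _ => zero_le)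
      (fun N => localGibbsLaw_preimage_flow_le_zero (Φ N) t
        {w | δ < |empiricalDensityField w χ - ∫ x, χ x * (1 : ℝ)|})
  · exact tendsto_of_tendsto_of_tendsto_of_le_of_le tendsto_const_nhds h2 (fun _ => zero_le)
      (fun N => localGibbsLaw_preimage_flow_le_zero (Φ N) t
        {w | δ < ‖empiricalMomentumField w χ - ∫ x, (χ x * (1 : ℝ)) • (0 : V3)‖})
  · exact tendsto_of_tendsto_of_tendsto_of_le_of_le tendsto_const_nhds h3 (fun _ => zero_le)
      (fun N => localGibbsLaw_preimage_flow_le_zero (Φ N) t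
        {w | δ < |empiricalEnergyField w χ - ∫ x, χ x * totalEnergyDensity 1 0 1|})

end Summit.AtomisticToContinuum.HydrodynamicLimit.Theorems.DensityCapNegative

end
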